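import Summits.ResolutionOfSingularities.ResolutionOfSingularities.Theorems.GaloisDescentLU3
import Literature.AlgebraicGeometry.Resolution.TameCyclicToricDescentModels
import Literature.AlgebraicGeometry.Resolution.ExcellentRingsFieldProofs
import Literature.AlgebraicGeometry.Resolution.AffineModelLU
import HarnessLib

/-!
# TameQuotientLU — the TAME QUOTIENT LAW: equivariant uniformization above a tame cyclic top comes down (decomp-res node «QuotientLadder», lens-1 g25)

HOME node file `HOME/decomp-res-lens-1/g25/TameQuotientLU.lean` (HOME = run/shared/lean/pub/decomp-res; NODE-g25.md), namespace
`…Theorems.TameQuotientLU`, typed against the LANDED `Theorems.GaloisDescentLU3` (p811460: located residual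
`NonKHToricArchLUKeyHenselDescent`, `closes_descent`) and the Literature (C4) bricks `TameCyclicToricDescentModels`
(`exists_fixed_model_isRegularLocalRing`: [CoP1] = Cossart–Piltant 2008, proof of Lemma 9.4, HAL pp. 28–29, toric route;
[CossartPiltant2019] §4.1, Prop. 4.10), `ExcellentRingsFieldProofs` (finite type over a field ⇒ universally catenary),
`AffineModelLU` (`valuation_comap_lt_one_iff`); nothing inlined, no port, NO `TheoremD`, NO `TheoremH`; a pure addition.
Landing target: `Summits/ResolutionOfSingularities/ResolutionOfSingularities/Theorems/TameQuotientLU.lean`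
(`--kind proof --supports stmt-ResolutionOfSingularities-0641`, HELPER file of the host route `Valuative`).

WINDOW g25 (CRITIC-LEDGER row 187), kind (W-tame): a law that ELIMINATES A WHOLE KIND from the located residual.  THE KIND:
places `(K, O)` over `k` admitting a TAME CYCLIC KUMMER TOP — `K′ | K` cyclic Galois of order dividing `ℓ`, `ℓ ∈ k×`,
`μ_ℓ ⊆ k`, its group `⟨σ⟩` fixing a valuation ring `O′` above `O` (`G = G_Z`) with residues in `k` — over which
`σ`-EQUIVARIANT relative local uniformization holds: every finitely generated model `R ⊆ O` of `K` lies in a `σ`-STABLE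
finitely generated model `R[t₀] ⊆ O′` of `K′` regular at the centre of `O′` (`TameEquivariantLUAbove k O`, TYPED).  THE LAW
(`relLU_of_tameEquivariantLUAbove`, kernel, HYPOTHESIS-FREE): such a place admits relative local uniformization — the
invariant model `R[t₀]^σ` is finitely generated over the universally catenary base `R`, and Cossart–Piltant's TORIC CHART
over it (invariant-lattice basis of non-negative value; Literature `InvariantLatticeToricChart`, `TameCyclicToricDescent`)
is a finitely generated model `R[t] ⊆ O` of `K`, `R ⊆ R[t]`, regular at the centre of `O`.  No henselization, no key
polynomials, no eigen-frame, no completion: the quotient is taken on the MODEL, not inside a chart of coordinates (the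
in-chart linearisation of row 187 is FALSE in general — NODE-g25.md §1, CE-1 — while the model-level quotient always works).

THIS FILE: PART A the cell `TameEquivariantLUAbove` and THE LAW; PART B the cell piece `NonKHToricArchLUKeyHenselDescentQuotCell`
(DECIDED), the new located residual `NonKHToricArchLUKeyHenselDescentQuot e c n` (off the key-chain, Hensel, descent AND
tame-quotient cells), the exact hypothesis-free cut `nonKHToricArchLUKeyHenselDescent_iff_quot` (+ `(3,3,4)` instance,
g17/g20 family form), `…Quot_of_root` (WEAKER than the root), ROOT BY NAME `closes_quot`, `root_iff_quot_sigma`.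

[WRITER NOTE (decomp-res writer g12): the lens file (400 l, sha256 00534be0) is split in two at `end Law` exactly as its WRITER.md e73b5a9a
prescribes for the tree's 400-line cap — this file = PART A (`section Law`), `TameQuotientLU2` = PART B (`section Cut`); namespace, sections,
variables / opens and every declaration VERBATIM.  Provenance: decomp-res lens-1 g25 node «QuotientLadder» (HOME = run/shared/lean/pub/decomp-res,
`HOME/decomp-res-lens-1/g25/TameQuotientLU.lean`), critic CRITIC-LEDGER row 193 CLEARED +1 (INBOX 07:23:35Z), lens farm rc 0 · 0 sorry · std axioms;
`--supports stmt-ResolutionOfSingularities-0641 --as helper` (route Valuative column; no aside switch, no items by the writer).]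
-/

noncomputable section

open IntermediateField Polynomial Literature.AlgebraicGeometry.Resolution

namespace Summit.ResolutionOfSingularities.ResolutionOfSingularities.Theorems.TameQuotientLU

/-! ## PART A — the TAME-QUOTIENT CELL of a place `(K, O)` over `k` and THE LAW -/

section Law

variable (k : Type) [Field k] {K : Type} [Field K] [Algebra k K]

/-- The model `R[t₀]` UPSTAIRS: the subring of `K′` generated by (the image of) a `k`-subalgebra `R ⊆ K` and a
finite set `t₀ ⊆ K′` (Cossart–Piltant's / Novacoski–Spivakovsky's finitely generated models `S[t]`, with base
`S = R`). [cite: CossartPiltant2019, Section 4.1 (LU)] [cite: NovacoskiSpivakovsky2014, Def. 2.8] -/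
abbrev modelAbove (R : Subalgebra k K) (K' : IntermediateField K (AlgebraicClosure K)) (t₀ : Finset K') :
    Subring K' :=
  Subring.closure (((R.toSubring.map (algebraMap K K' : K →+* K')) : Set K') ∪ (t₀ : Set K'))

/-- **The TAME-QUOTIENT CELL of a place `(K, O)` over `k`** (TYPED, syntactic): there are a finite CYCLIC Galois
extension `K′ | K` (realised in `K̄`) with generator `σ`, `σ ^ ℓ = 1`, `ℓ ∈ k×`, a primitive `ℓ`-th root of unity
`ζ ∈ k` (Kummer situation `μ_ℓ ⊆ k`), and a valuation ring `O′` of `K′` above `O` FIXED by `σ` (`G = G_Z`) with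
residues in `k`, such that `σ`-EQUIVARIANT RELATIVE LOCAL UNIFORMIZATION HOLDS UPSTAIRS OVER THE MODELS OF `K`:
every finitely generated model `R ⊆ O` of `K` over `k` lies in a `σ`-STABLE finitely generated model `R[t₀] ⊆ O′` of
`K′` whose local ring at the centre of `O′` is regular.  Generic inhabitants: tame cyclic Kummer tops `K′ = K(θ)`,
`θ^ℓ ∈ K`, uniformized equivariantly ([CossartPiltant2008, Lemma 9.4: "S is stable by G"]; [CossartPiltant2019,
Prop. 4.10, (LUvi) ⇒ (LUv)]); NODE-g25.md §1 (CE-1) is a certified instance on which the in-chart mechanism fails.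
[cite: CossartPiltant2008, Lemma 9.4] [cite: CossartPiltant2019, Prop. 4.10] -/
def TameEquivariantLUAbove (O : ValuationSubring K) : Prop :=
  ∃ K' : IntermediateField K (AlgebraicClosure K), FiniteDimensional K K' ∧ IsGalois K K' ∧
  ∃ σ : K' ≃ₐ[K] K', (∀ g : K' ≃ₐ[K] K', ∃ i : ℕ, g = σ ^ i) ∧
  ∃ ℓ : ℕ, 0 < ℓ ∧ (ℓ : k) ≠ 0 ∧ σ ^ ℓ = 1 ∧
  ∃ ζ : k, IsPrimitiveRoot ζ ℓ ∧
  ∃ O' : ValuationSubring K', O'.comap (algebraMap K K') = O ∧ (∀ y : K', y ∈ O' ↔ σ y ∈ O') ∧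
    (∀ y ∈ O', ∃ c : k, y - algebraMap k K' c ∈ O'.nonunits) ∧
  ∀ R : Subalgebra k K, R.FG → IsFractionRing R K → R.toSubring ≤ O.toSubring →
    ∃ t₀ : Finset K', modelAbove k R K' t₀ ≤ O'.toSubring ∧
      (∀ y ∈ modelAbove k R K' t₀, σ y ∈ modelAbove k R K' t₀) ∧
      IsRegularLocalRing (locAtCentre (modelAbove k R K' t₀) O')

variable {k}

/-- Powers of an algebra automorphism, read as a ring automorphism. [folklore] -/
theorem toRingEquiv_pow_apply {K' : Type} [Field K'] [Algebra K K'] (σ : K' ≃ₐ[K] K') (n : ℕ) (x : K') :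
    ((σ : K' ≃+* K') ^ n) x = (σ ^ n) x := by
  induction n generalizing x with
  | zero => rfl
  | succ n ih =>
    rw [pow_succ, pow_succ, RingAut.mul_apply, AlgEquiv.mul_apply]
    exact ih (σ x)

/-- `σ ^ ℓ = 1` as ring automorphisms. [folklore] -/
theorem toRingEquiv_pow_eq_one {K' : Type} [Field K'] [Algebra K K'] {σ : K' ≃ₐ[K] K'} {ℓ : ℕ}
    (h : σ ^ ℓ = 1) : (σ : K' ≃+* K') ^ ℓ = 1 := by
  ext x
  rw [toRingEquiv_pow_apply, h]
  rfl

/-- An automorphism fixing a valuation ring (`y ∈ O′ ↔ σ y ∈ O′`) preserves "`v < 1`". [folklore] -/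
theorem valuation_map_lt_one_of_stable {K' : Type} [Field K'] [Algebra K K'] {σ : K' ≃ₐ[K] K'}
    {O' : ValuationSubring K'} (hσO' : ∀ y : K', y ∈ O' ↔ σ y ∈ O') {y : K'}
    (hy : O'.valuation y < 1) : O'.valuation (σ y) < 1 := by
  by_cases hy0 : y = 0
  · simp [hy0]
  rw [← not_le] at hy ⊢
  intro hle
  apply hy
  have h1 : (σ y)⁻¹ ∈ O' := by
    rw [← O'.valuation_le_one_iff, map_inv₀]
    exact (inv_le_one₀ (zero_lt_one.trans_le hle)).mpr hle
  have h2 : y⁻¹ ∈ O' := by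
    rw [hσO', map_inv₀]
    exact h1
  have h3 := (O'.valuation_le_one_iff _).mpr h2
  rwa [map_inv₀, inv_le_one₀ ((Valuation.pos_iff _).mpr hy0)] at h3

/-- In a finite cyclic Galois extension, an element fixed by the generator lies in the ground field.
[folklore] -/
theorem exists_algebraMap_eq_of_fixed {K' : Type} [Field K'] [Algebra K K'] [FiniteDimensional K K']
    [IsGalois K K'] {σ : K' ≃ₐ[K] K'} (hcyc : ∀ g : K' ≃ₐ[K] K', ∃ i : ℕ, g = σ ^ i) {z : K'}
    (hz : σ z = z) : ∃ x : K, algebraMap K K' x = z := by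
  have hz' : ∀ i : ℕ, (σ ^ i) z = z := by
    intro i
    induction i with
    | zero => rfl
    | succ i ih => rw [pow_succ, AlgEquiv.mul_apply, hz, ih]
  have hmem : z ∈ IntermediateField.fixedField (⊤ : Subgroup (K' ≃ₐ[K] K')) := by
    rw [IntermediateField.mem_fixedField_iff]
    intro g _
    obtain ⟨i, rfl⟩ := hcyc g
    exact hz' i
  rw [IsGalois.fixedField_top, IntermediateField.mem_bot] at hmem
  exact hmem

set_option maxHeartbeats 1600000 in
/-- **THE TAME QUOTIENT LAW (kernel, hypothesis-free): equivariant uniformization above a tame cyclic Kummer top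
COMES DOWN.**  Given a finitely generated model `R ⊆ O` of `K`, let `R[t₀] ⊆ O′` be the `σ`-stable regular model of
the cell.  The base `R` (read in `K′`) is finitely generated over `k`, hence universally catenary, fixed by `σ`, and
contains `ℓ⁻¹, ζ`; `σ` is residually trivial and `κ(O′) | k` algebraic (residues in `k`).  Cossart–Piltant's toric
descent step for models (`exists_fixed_model_isRegularLocalRing`: invariants `R[t₀]^σ = R[g]` finitely generated,
invariant-lattice toric chart `y`, `R[g, y]` regular at the centre) yields `σ`-FIXED `t ⊆ O′` with `R[t]` regular at
the centre of `O′`; fixed elements of the cyclic Galois extension lie in `K` (`exists_algebraMap_eq_of_fixed`), so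
`R[t] = A ⊆ O` is a finitely generated `k`-subalgebra of `K` containing `R`, whose local ring at the centre of
`O = O′ ∩ K` is that of `R[t]` at the centre of `O′` (transport along `K ↪ K′`, `IsLocalization.ringEquivOfRingEquiv`).
[cite: CossartPiltant2008, proof of Lemma 9.4 (HAL pp. 28–29)] [cite: CossartPiltant2019, Prop. 4.10] -/
theorem relLU_of_tameEquivariantLUAbove {O : ValuationSubring K} (h : TameEquivariantLUAbove k O) :
    RelLocalUniformization k K O := by
  classical
  intro R hRfg hRfrac hRO
  obtain ⟨K', hfin, hgal, σ, hcyc, ℓ, hℓ, hℓk, hσℓ, ζ, hζ, O', hO'O, hσO', hκ', hLU⟩ := h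
  obtain ⟨t₀, hT₀O, hσT₀, hreg⟩ := hLU R hRfg hRfrac hRO
  haveI := hfin
  haveI := hgal
  haveI := hreg
  have hfinj : Function.Injective (algebraMap K K' : K →+* K') := (algebraMap K K').injective
  -- (1) membership in `O` and `v < 1` are read upstairs (`O = O′ ∩ K`)
  have hmemO : ∀ x : K, x ∈ O ↔ algebraMap K K' x ∈ O' := fun x => by
    rw [← hO'O]
    rfl
  have hvalO : ∀ y : K, O.valuation y < 1 ↔ O'.valuation (algebraMap K K' y) < 1 := fun y => by
    rw [← valuation_comap_lt_one_iff O' (algebraMap K K' : K →+* K') y, hO'O]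
  -- (2) `σ` fixes `K` and `k`
  have hσf : ∀ x : K, σ (algebraMap K K' x) = algebraMap K K' x := fun x => σ.commutes x
  have hfk : ∀ c : k, algebraMap K K' (algebraMap k K c) = algebraMap k K' c := fun c =>
    (IsScalarTower.algebraMap_apply k K K' c).symm
  have hσk : ∀ c : k, σ (algebraMap k K' c) = algebraMap k K' c := fun c => by
    rw [← hfk]
    exact hσf _
  -- (3) the base `S = R` read in `K′`
  have hRS : ∀ x ∈ R, algebraMap K K' x ∈ R.toSubring.map (algebraMap K K' : K →+* K') :=
    fun x hx => Subring.mem_map.mpr ⟨x, hx, rfl⟩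
  have hσS : ∀ s ∈ R.toSubring.map (algebraMap K K' : K →+* K'), (σ : K' ≃+* K') s = s := by
    intro s hs
    obtain ⟨x, -, rfl⟩ := Subring.mem_map.mp hs
    exact hσf x
  haveI : Algebra.FiniteType k R := (Subalgebra.fg_iff_finiteType R).mp hRfg
  have hSuc : IsUniversallyCatenaryRing (R.toSubring.map (algebraMap K K' : K →+* K')) :=
    (isUniversallyCatenaryRing_of_finiteType_field k R).of_surjective
      ((algebraMap K K' : K →+* K').restrict R (R.toSubring.map (algebraMap K K' : K →+* K')) hRS) (by
        rintro ⟨y, hy⟩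
        obtain ⟨x, hx, rfl⟩ := Subring.mem_map.mp hy
        exact ⟨⟨x, hx⟩, rfl⟩)
  have hkS : ∀ c : k, algebraMap k K' c ∈ R.toSubring.map (algebraMap K K' : K →+* K') := fun c => by
    rw [← hfk]
    exact hRS _ (R.algebraMap_mem c)
  let ψ : k →+* R.toSubring.map (algebraMap K K' : K →+* K') := (algebraMap k K').codRestrict _ hkS
  have hℓ0 : ℓ ≠ 0 := hℓ.ne'
  have hℓu : IsUnit ((ℓ : R.toSubring.map (algebraMap K K' : K →+* K'))) := by
    rw [← map_natCast ψ ℓ]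
    exact (IsUnit.mk0 _ hℓk).map ψ
  have hζS : algebraMap k K' ζ ∈ R.toSubring.map (algebraMap K K' : K →+* K') := hkS ζ
  have hζℓ : (algebraMap k K' ζ) ^ ℓ = 1 := by
    rw [← map_pow, hζ.pow_eq_one, map_one]
  have hζu : ∀ j : ℕ, 0 < j → j < ℓ →
      IsUnit ((⟨algebraMap k K' ζ, hζS⟩ : R.toSubring.map (algebraMap K K' : K →+* K')) ^ j - 1) := by
    intro j hj hjℓ
    have hne : ζ ^ j - 1 ≠ 0 := sub_ne_zero.mpr (hζ.pow_ne_one_of_pos_of_lt hj.ne' hjℓ)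
    have hψζ : (⟨algebraMap k K' ζ, hζS⟩ : R.toSubring.map (algebraMap K K' : K →+* K')) = ψ ζ :=
      Subtype.ext rfl
    rw [hψζ, ← map_pow, ← map_one ψ, ← map_sub]
    exact (IsUnit.mk0 _ hne).map ψ
  -- (4) `σ` fixes `O′`, is residually trivial, and `κ(O′) | k` is algebraic
  have hσO'' : ∀ x ∈ O', (σ : K' ≃+* K') x ∈ O' := fun x hx => (hσO' x).mp hx
  have hres : ∀ b ∈ locAtCentre (modelAbove k R K' t₀) O', O'.valuation ((σ : K' ≃+* K') b - b) < 1 := by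
    intro b hb
    obtain ⟨c, hc⟩ := hκ' b (locAtCentre_le hT₀O hb)
    have h1 : O'.valuation (b - algebraMap k K' c) < 1 := (O'.mem_nonunits_iff).mp hc
    have h2 : O'.valuation (σ (b - algebraMap k K' c)) < 1 := valuation_map_lt_one_of_stable hσO' h1
    have h3 : (σ : K' ≃+* K') b - b = σ (b - algebraMap k K' c) - (b - algebraMap k K' c) := by
      rw [map_sub, hσk, AlgEquiv.coe_ringEquiv]
      ring
    rw [h3]
    exact lt_of_le_of_lt (Valuation.map_sub _ _ _) (max_lt h2 h1)
  have halg : ∀ z : O', ∃ q : Polynomial (R.toSubring.map (algebraMap K K' : K →+* K')),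
      (∃ i, IsUnit (q.coeff i)) ∧ O'.valuation (Polynomial.aeval (z : K') q) < 1 := by
    intro z
    obtain ⟨c, hc⟩ := hκ' z z.2
    refine ⟨X - C (ψ c), ⟨1, by simp⟩, ?_⟩
    have h1 : Polynomial.aeval (z : K') (X - C (ψ c) : Polynomial (R.toSubring.map
        (algebraMap K K' : K →+* K'))) = z - algebraMap k K' c := by
      rw [map_sub, aeval_X, aeval_C]
      rfl
    rw [h1]
    exact (O'.mem_nonunits_iff).mp hc
  -- (5) Cossart–Piltant's toric descent step for models
  obtain ⟨t, hσt, hTO, hTreg⟩ := exists_fixed_model_isRegularLocalRing O' (σ : K' ≃+* K') hσO''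
    (R.toSubring.map (algebraMap K K' : K →+* K')) hσS hSuc t₀ hT₀O hσT₀ hreg
    (IsRegularLocalRing.spanFinrank_maximalIdeal (R := locAtCentre (modelAbove k R K' t₀) O')).symm
    hres halg hℓ0 (toRingEquiv_pow_eq_one hσℓ) hℓu (algebraMap k K' ζ) hζS hζℓ hζu
  -- (6) the fixed generators lie in `K`: pull the model back to `K`
  have ht_sub : (t : Set K') ⊆ Set.range (algebraMap K K' : K →+* K') := fun z hz =>
    exists_algebraMap_eq_of_fixed hcyc (hσt z hz)
  let tK : Finset K := t.preimage (algebraMap K K') (hfinj.injOn)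
  have hftK : (algebraMap K K' : K →+* K') '' (tK : Set K) = (t : Set K') := by
    rw [Finset.coe_preimage]
    exact Set.image_preimage_eq_of_subset ht_sub
  obtain ⟨s₀, hs₀⟩ := hRfg
  let A₀ : Subalgebra k K := Algebra.adjoin k ((s₀ : Set K) ∪ (tK : Set K))
  have hRA₀ : R ≤ A₀ := by
    rw [← hs₀]
    exact Algebra.adjoin_mono Set.subset_union_left
  have hA₀fg : A₀.FG := ⟨s₀ ∪ tK, by rw [Finset.coe_union]⟩
  have hRcl : R.toSubring = Subring.closure (Set.range (algebraMap k K) ∪ (s₀ : Set K)) := by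
    rw [← hs₀]
    exact Algebra.adjoin_eq_ring_closure _
  have hA₀cl : A₀.toSubring = Subring.closure (Set.range (algebraMap k K) ∪ ((s₀ : Set K) ∪ (tK : Set K))) :=
    Algebra.adjoin_eq_ring_closure _
  have hT : A₀.toSubring.map (algebraMap K K' : K →+* K') =
      Subring.closure (((R.toSubring.map (algebraMap K K' : K →+* K')) : Set K') ∪ (t : Set K')) := by
    have e1 : ((R.toSubring.map (algebraMap K K' : K →+* K') : Subring K') : Set K') =
        (Subring.closure ((algebraMap K K' : K →+* K') '' (Set.range (algebraMap k K) ∪ (s₀ : Set K))) :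
          Set K') := by
      rw [hRcl, RingHom.map_closure]
    rw [hA₀cl, RingHom.map_closure, e1, Subring.closure_union, Subring.closure_eq, ← Subring.closure_union]
    simp only [Set.image_union, hftK, Set.union_assoc]
  have hA₀O : A₀.toSubring ≤ O.toSubring := by
    intro x hx
    have hfx : algebraMap K K' x ∈ A₀.toSubring.map (algebraMap K K' : K →+* K') :=
      Subring.mem_map.mpr ⟨x, hx, rfl⟩
    rw [hT] at hfx
    exact (hmemO x).mpr (hTO hfx)
  refine ⟨A₀, hA₀O, hRA₀, hA₀fg, ?_⟩
  -- (7) transport of the local ring at the centre along `K ↪ K′`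
  let g : A₀.toSubring ≃+*
      Subring.closure (((R.toSubring.map (algebraMap K K' : K →+* K')) : Set K') ∪ (t : Set K')) :=
    (A₀.toSubring.equivMapOfInjective (algebraMap K K' : K →+* K') hfinj).trans (RingEquiv.subringCongr hT)
  have hg : ∀ x : A₀.toSubring, ((g x : Subring.closure (((R.toSubring.map
      (algebraMap K K' : K →+* K')) : Set K') ∪ (t : Set K'))) : K') = algebraMap K K' x := fun _ => rfl
  set P : Ideal A₀.toSubring := Ideal.comap (Subring.inclusion hA₀O) (IsLocalRing.maximalIdeal O) with hP
  set P' := subringCentre (Subring.closure (((R.toSubring.map (algebraMap K K' : K →+* K')) : Set K') ∪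
    (t : Set K'))) O' hTO with hP'
  haveI hregP' : IsRegularLocalRing (Localization.AtPrime P') :=
    (isRegularLocalRing_locAtCentre_iff hTO).mp hTreg
  have hPP' : P = P'.comap g.toRingHom := by
    ext x
    simp only [hP, hP', Ideal.mem_comap, RingEquiv.toRingHom_eq_coe, RingHom.coe_coe,
      mem_subringCentre_iff]
    rw [ValuationSubring.valuation_lt_one_iff, hg]
    exact hvalO x
  have hmap : Submonoid.map g.toRingHom.toMonoidHom P.primeCompl = P'.primeCompl := by
    ext y
    constructor
    · rintro ⟨x, hx, rfl⟩
      change g x ∉ P'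
      have hx' : x ∉ P := hx
      rw [hPP', Ideal.mem_comap] at hx'
      exact hx'
    · intro hy
      have hy' : y ∉ P' := hy
      refine ⟨g.symm y, ?_, ?_⟩
      · change g.symm y ∉ P
        rw [hPP', Ideal.mem_comap]
        change ¬ g (g.symm y) ∈ P'
        rw [g.apply_symm_apply]
        exact hy'
      · change g (g.symm y) = y
        exact g.apply_symm_apply y
  exact IsRegularLocalRing.of_ringEquiv (R := Localization.AtPrime P')
    (IsLocalization.ringEquivOfRingEquiv (Localization.AtPrime P) (Localization.AtPrime P') g hmap).symm

end Law

end Summit.ResolutionOfSingularities.ResolutionOfSingularities.Theorems.TameQuotientLU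

end
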